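import Literature.MathematicalPhysics.StatisticalMechanics.TriangularLatticeEdgeIsoperimetry
import Literature.Geometry.DiscreteGeometry.HexagonalBonnesenInequality
import HarnessLib

/-!
# Davoli–Piovano–Stefanelli 2017, Proposition 3.7 and Corollary 1.3 PROVED: the maximal hexagon
# of an edge-isoperimetric minimizer on the triangular lattice

Topic `Literature/MathematicalPhysics/StatisticalMechanics`; sequel to
`TriangularLatticeEdgeIsoperimetry.lean` (Davoli–Piovano–Stefanelli 2017 typed: Theorem 1.1 proved,
Proposition 3.7 / Theorem 1.2 / Corollary 1.3 / Theorem 1.4 named facts) and to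
`Literature/Geometry/DiscreteGeometry/HexagonalBonnesenInequality.lean` (erosion by hexagons and the
discrete Bonnesen inequality `n + 3(r+1)² ≤ (r+1) L + 1` for 3-convex label sets).  Cell
`crystal3d-full`, literature-typing layer D-0088 (4), seat `littype-FC1-1` (gen 10).  This file
DISCHARGES two of the named facts of the first file:

* `DavoliPiovanoStefanelli2017_maximalRadius_holds` — **Proposition 3.7** (p. 651), the lower bound
  (69) `r_{M_n} ≥ ⌈α_n⌉/6 − 2 − (1/6)√(⌈α_n⌉² − α_n² + 75)`, `α_n = √(12n − 3)`, on the radius of the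
  maximal hexagon `H_{r_{M_n}}` of every minimizer `M_n` of the edge-isoperimetric problem on `𝓛_t` —
  the estimate from which the sharp `N^{3/4}` law (Theorem 1.2 (15), `K_t = 2/3^{1/4}`) follows;
* `DavoliPiovanoStefanelli2017_hausdorff_holds` — **Corollary 1.3** (p. 633), `d_H(M_n, H_{r_{M_n}}) ≤
  2·3^{1/4} n^{1/4} + O(1)`, with the explicit `O(1) = 3 + √10`.

## Source, as printed, and the proof formalised

[DavoliPiovanoStefanelli2017] = E. Davoli, P. Piovano, U. Stefanelli, J. Nonlinear Sci. **27** (2017)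
627–660 (open access), §3: Proposition 3.3 (minimizers are 3-convex), (59)–(62) (the levels `λ_k`,
`Σ λ_k ≤ p_n − 6r`), Lemma 3.4, Proposition 3.5, Lemma 3.6, and Proposition 3.7 with its proof via
"(71) `3r² − (p_n − 9) r + n − 2p_n ≤ 0`. Estimate (69) follows from (71) by solving (71) with respect
to `r` and recalling that `p_n = θ_n/2 − 3` by Theorem 1.1 and `θ_n = 2⌈α_n⌉` by (12)"; proof of
Corollary 1.3 p. 652: "`d_H(M_n, H_{r_{M_n}}) ≤ max λ_i ≤ p_n − 6r_{M_n} ≤ 9 + √(⌈α_n⌉² − α_n² + 75)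
≤ … ≤ 2·3^{1/4} n^{1/4} + O(1)`".

OUR ROUTE replaces the region bookkeeping (59)–(68) by the discrete Bonnesen inequality of
`HexagonalBonnesenInequality.lean`, applied to the label set `S` of `M_n = triPoint(S)`:
1. minimizers attain Harborth's bound (`isTriMinimizer_image_triPoint_iff`), hence are row-convex in
   the three lattice directions (`isRowConvex_of_adjCount_eq` for `S`, `rot6 S`, `rot6² S`:
   `isTriConvex_of_adjCount_eq` — [DPS17, Proposition 3.3]) and `L(S) = 3n − b = ⌈√(12n−3)⌉`
   (`lineCount_eq_ceil`, [DPS17, (10)–(12)]);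
2. the maximal radius (55) is the largest `r` with `S ⊖ H_r ≠ ∅` (`maxHexRadius_image_triPoint_spec`);
3. `n + 3(r+1)² ≤ (r+1)⌈α_n⌉ + 1` (`card_add_sq_le_lineCount`) and the algebra of p. 652 give (69)
   (with room: for `c := ⌈α_n⌉ ≥ 6r + 12` one gets `(c − 12 − 6r)² + 12(c − 6r) − 42 ≤ c² − α_n² + 78`);
4. for Corollary 1.3: minimizers meet every lattice line between two occupied parallel lines
   (`values_ordConnected_of_adjCount_eq`, by the strict superadditivity
   `harborthNumber a + harborthNumber b + 1 ≤ harborthNumber (a + b)` — [DPS17, p. 630 "minimizers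
   … need to be connected"]), so every label of `S` is within hexagonal distance
   `Λ := ⌈α_n⌉ − 3 − 6r` (`= p_n − 6r_{M_n}`, cf. (62)) of the maximal hexagon, lattice paths of
   hexagonal length `ℓ` have Euclidean length `≤ ℓ`, and `Λ ≤ 3 + √(⌈α_n⌉² − α_n² + 9) ≤
   3 + √(2α_n + 10) ≤ 2·3^{1/4} n^{1/4} + 3 + √10`.

## Contents (namespace `Literature.MathematicalPhysics.StatisticalMechanics.DavoliPiovanoStefanelli2017`)

§1 label-level minimizers: `adjCount_image_rot6`, `isTriConvex_of_adjCount_eq`, `lineCount_eq_ceil`,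
`harborthNumber_superadditive`, `values_ordConnected_of_adjCount_eq`.  §2 bridge:
`hexConfig_triPoint_subset_iff`, `maxHexRadius_image_triPoint_spec`.  §3 Proposition 3.7:
`radius_lower_bound` (label form), `DavoliPiovanoStefanelli2017_maximalRadius_holds`; the explicit
`N^{3/4}`-law count `card_sub_card_hexagon_le` ((74) with explicit lower-order terms).  §4 Corollary 1.3:
`norm_triPoint_le_of_mem_hexagon`, `exists_mem_hexagon_norm_sub_le`, `sub_mem_hexagon_of_mem`,
`lambda_le`, `DavoliPiovanoStefanelli2017_hausdorff_holds`.  §5 Theorem 1.2 (15) with the sharp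
constant: `lambda_le_sqrt`, `card_sub_card_hexagon_le_real`, `card_sub_card_hexagon_le_sharpConstant`
(`n − #H_r ≤ K_t n^{3/4} + 6√n + 5`), `card_sub_card_maxHexagon_le`,
`eventually_card_sub_card_maxHexagon_le` (for every `δ > 0`, eventually every minimizer has
`|M_n ∖ H_{r_{M_n}}| ≤ (K_t + δ) n^{3/4}` — the (15)-clause of `DavoliPiovanoStefanelli2017_wulffShape`).
-/

noncomputable section

open Set Filter Function Metric Finset
open scoped Topology Pointwise

namespace Literature.MathematicalPhysics.StatisticalMechanics.DavoliPiovanoStefanelli2017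

open CicaleseLeonardi2020 (IsAlmostMinimal)
open Theil2006 (Plane triPoint triangularLattice triPoint_injective)
open Literature.Geometry.DiscreteGeometry (harborthNumber adjCount_le_two_mul_harborthNumber)
open Literature.Geometry.DiscreteGeometry.Harborth (harborthNumber_eq_sub_ceil)
open Literature.Geometry.DiscreteGeometry.HarborthSpiral (hexagon mem_hexagon Inside Adj adjCount
  normForm normForm_eq_one_iff adj_comm rot6 rot6inv rot6_rot6inv rot6inv_rot6 adj_rot6_iff
  IsRowConvex isRowConvex_of_adjCount_eq bondCount adjCount_eq_two_mul_bondCount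
  erode erodeN bdLayer lineCount IsTriConvex mem_erodeN erodeN_zero erodeN_antitone
  lt_card_of_erodeN_nonempty card_image_rot6 mem_image_rot6 rot6_injective bondCount_add_lineCount
  card_add_sq_le_lineCount six_mul_add_three_le_lineCount exists_step_mem_hexagon hexagon_mono
  zero_mem_hexagon' image_snd_image_rot6 image_snd_image_rot6_rot6)

/-! ## §1 Minimizers at label level: 3-convexity, the line count, line-connectedness -/

/-- The rotation `rot6` preserves the ordered adjacency count. [cite: HeitmannRadin1980, §2 (p. 283)] -/
theorem adjCount_image_rot6 (S : Finset (ℤ × ℤ)) : adjCount (S.image rot6) = adjCount S := by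
  classical
  unfold adjCount
  rw [Finset.sum_image fun a _ b _ h => rot6_injective h]
  refine Finset.sum_congr rfl fun q _ => ?_
  have : (S.image rot6).filter (Adj (rot6 q)) = (S.filter (Adj q)).image rot6 := by
    ext x
    simp only [Finset.mem_filter, Finset.mem_image]
    constructor
    · rintro ⟨⟨y, hy, rfl⟩, had⟩
      exact ⟨y, ⟨hy, (adj_rot6_iff q y).1 had⟩, rfl⟩
    · rintro ⟨y, ⟨hy, had⟩, rfl⟩
      exact ⟨⟨y, hy, rfl⟩, (adj_rot6_iff q y).2 had⟩
  rw [this, Finset.card_image_of_injective _ rot6_injective]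

/-- **[DPS17, Proposition 3.3] Minimizers are 3-convex**: a label set attaining Harborth's bound is
row-convex in all three lattice directions (the tree's `isRowConvex_of_adjCount_eq` — a row with a
gap costs a contact — applied to `S`, `rot6 S`, `rot6² S`). [cite: DavoliPiovanoStefanelli2017, Proposition 3.3 p. 644] -/
theorem isTriConvex_of_adjCount_eq {S : Finset (ℤ × ℤ)}
    (hmax : 2 * harborthNumber S.card ≤ (adjCount S : ℤ)) : IsTriConvex S := by
  refine ⟨isRowConvex_of_adjCount_eq hmax, isRowConvex_of_adjCount_eq ?_, isRowConvex_of_adjCount_eq ?_⟩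
  · rwa [card_image_rot6, adjCount_image_rot6]
  · rwa [card_image_rot6, card_image_rot6, adjCount_image_rot6, adjCount_image_rot6]

/-- **The line count of a minimizer is `⌈√(12n − 3)⌉ = θ_n/2`** (`= p_n + 3`): `b + L = 3n` for
3-convex sets and `b = [3n − √(12n−3)] = 3n − ⌈√(12n−3)⌉`. [cite: DavoliPiovanoStefanelli2017, (10)–(12) p. 630] -/
theorem lineCount_eq_ceil {S : Finset (ℤ × ℤ)} (hmax : 2 * harborthNumber S.card ≤ (adjCount S : ℤ)) :
    (lineCount S : ℤ) = ⌈Real.sqrt (12 * S.card - 3)⌉ := by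
  have h1 := bondCount_add_lineCount (isTriConvex_of_adjCount_eq hmax)
  have h2 := adjCount_le_two_mul_harborthNumber S
  have h3 := adjCount_eq_two_mul_bondCount S
  have h4 := harborthNumber_eq_sub_ceil S.card
  have h5 : (bondCount S : ℤ) = harborthNumber S.card := by
    have : (adjCount S : ℤ) = 2 * bondCount S := by exact_mod_cast h3
    linarith
  have h6 : ((bondCount S : ℕ) : ℤ) + lineCount S = 3 * S.card := by exact_mod_cast h1
  rw [h5, h4] at h6
  linarith

/-- `√(12a − 3) ≥ 3` for `a ≥ 1`. [cite: DavoliPiovanoStefanelli2017, (12) p. 630] -/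
private theorem three_le_sqrt {a : ℕ} (ha : 1 ≤ a) : (3 : ℝ) ≤ Real.sqrt (12 * a - 3) := by
  have ha' : (1 : ℝ) ≤ a := by exact_mod_cast ha
  calc (3 : ℝ) = Real.sqrt (3 ^ 2) := by rw [Real.sqrt_sq (by norm_num)]
    _ ≤ Real.sqrt (12 * a - 3) := Real.sqrt_le_sqrt (by nlinarith)

/-- **Strict superadditivity of Harborth's number**: `[3a − √(12a−3)] + [3b − √(12b−3)] + 1 ≤
[3(a+b) − √(12(a+b)−3)]` for `a, b ≥ 1` (since `√(12(a+b)−3) ≤ √(12a−3) + √(12b−3) − 1`):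
two separated clusters never maximize the number of contacts ("minimizers of the EIP need to be
connected"). [cite: DavoliPiovanoStefanelli2017, p. 630] -/
theorem harborthNumber_superadditive {a b : ℕ} (ha : 1 ≤ a) (hb : 1 ≤ b) :
    harborthNumber a + harborthNumber b + 1 ≤ harborthNumber (a + b) := by
  rw [harborthNumber_eq_sub_ceil, harborthNumber_eq_sub_ceil, harborthNumber_eq_sub_ceil]
  set x := Real.sqrt (12 * a - 3) with hx
  set y := Real.sqrt (12 * b - 3) with hy
  have h3x : 3 ≤ x := three_le_sqrt ha
  have h3y : 3 ≤ y := three_le_sqrt hb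
  have ha' : (1 : ℝ) ≤ a := by exact_mod_cast ha
  have hb' : (1 : ℝ) ≤ b := by exact_mod_cast hb
  have hxsq : x ^ 2 = 12 * a - 3 := by
    rw [hx, Real.sq_sqrt (by linarith)]
  have hysq : y ^ 2 = 12 * b - 3 := by
    rw [hy, Real.sq_sqrt (by linarith)]
  have key : Real.sqrt (12 * ((a + b : ℕ) : ℝ) - 3) ≤ x + y - 1 := by
    have hnn : 0 ≤ x + y - 1 := by linarith
    calc Real.sqrt (12 * ((a + b : ℕ) : ℝ) - 3) ≤ Real.sqrt ((x + y - 1) ^ 2) :=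
          Real.sqrt_le_sqrt (by
            push_cast
            nlinarith [mul_nonneg (sub_nonneg.2 h3x) (sub_nonneg.2 h3y)])
      _ = x + y - 1 := Real.sqrt_sq hnn
  have hceil : ⌈Real.sqrt (12 * ((a + b : ℕ) : ℝ) - 3)⌉ ≤ ⌈x⌉ + ⌈y⌉ - 1 := by
    calc ⌈Real.sqrt (12 * ((a + b : ℕ) : ℝ) - 3)⌉ ≤ ⌈x + y - 1⌉ := Int.ceil_le_ceil key
      _ = ⌈x + y⌉ - 1 := by rw [Int.ceil_sub_one]
      _ ≤ ⌈x⌉ + ⌈y⌉ - 1 := by linarith [Int.ceil_add_le x y]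
  push_cast at hceil ⊢
  linarith

/-- Splitting off the labels below a value of a coordinate that no adjacency crosses: if the labels
of `S` with `f < v` and with `f > v` are never adjacent and no label has `f = v`, the adjacency count
splits. [cite: DavoliPiovanoStefanelli2017, p. 630] -/
private theorem adjCount_split {S : Finset (ℤ × ℤ)} (f : ℤ × ℤ → ℤ) (v : ℤ)
    (hf : ∀ p q : ℤ × ℤ, Adj p q → f q ≤ f p + 1) (hv : ∀ p ∈ S, f p ≠ v) :
    adjCount S = adjCount (S.filter fun p => f p < v) + adjCount (S.filter fun p => v < f p) := by
  classical
  set A := S.filter fun p => f p < v with hA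
  set B := S.filter fun p => v < f p with hB
  have hAB : Disjoint A B := by
    rw [hA, hB, disjoint_filter]; intro p _ h1 h2; omega
  have hS : S = A ∪ B := by
    ext p
    rw [Finset.mem_union, hA, hB, Finset.mem_filter, Finset.mem_filter]
    constructor
    · intro hp
      rcases lt_or_gt_of_ne (hv p hp) with h | h
      · exact Or.inl ⟨hp, h⟩
      · exact Or.inr ⟨hp, h⟩
    · rintro (⟨hp, -⟩ | ⟨hp, -⟩) <;> exact hp
  have hfilA : ∀ q ∈ A, S.filter (Adj q) = A.filter (Adj q) := by
    intro q hq
    rw [hA, mem_filter] at hq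
    ext p
    rw [hA, mem_filter, mem_filter, mem_filter]
    constructor
    · rintro ⟨hp, hadj⟩
      refine ⟨⟨hp, ?_⟩, hadj⟩
      have h1 := hf q p hadj
      have h2 := hv p hp
      omega
    · rintro ⟨⟨hp, -⟩, hadj⟩
      exact ⟨hp, hadj⟩
  have hfilB : ∀ q ∈ B, S.filter (Adj q) = B.filter (Adj q) := by
    intro q hq
    rw [hB, mem_filter] at hq
    ext p
    rw [hB, mem_filter, mem_filter, mem_filter]
    constructor
    · rintro ⟨hp, hadj⟩
      refine ⟨⟨hp, ?_⟩, hadj⟩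
      have h1 := hf p q ((adj_comm _ _).1 hadj)
      have h2 := hv p hp
      omega
    · rintro ⟨⟨hp, -⟩, hadj⟩
      exact ⟨hp, hadj⟩
  unfold adjCount
  have e : ∑ q ∈ S, (S.filter (Adj q)).card = ∑ q ∈ A ∪ B, (S.filter (Adj q)).card := by rw [← hS]
  have eA : ∑ q ∈ A, (S.filter (Adj q)).card = ∑ q ∈ A, (A.filter (Adj q)).card :=
    Finset.sum_congr rfl fun q hq => by rw [hfilA q hq]
  have eB : ∑ q ∈ B, (S.filter (Adj q)).card = ∑ q ∈ B, (B.filter (Adj q)).card :=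
    Finset.sum_congr rfl fun q hq => by rw [hfilB q hq]
  rw [e, Finset.sum_union hAB, eA, eB]

/-- **Minimizers are line-connected** in the direction measured by an "adjacency-Lipschitz"
coordinate `f` (`|f p − f q| ≤ 1` for adjacent labels; `f = n`, `m`, `m + n`): between two
attained values of `f` every value is attained — otherwise `S` splits into two bond-separated
clusters and strict superadditivity contradicts maximality. [cite: DavoliPiovanoStefanelli2017, p. 630 and Proposition 3.3 p. 644] -/
theorem values_ordConnected_of_adjCount_eq {S : Finset (ℤ × ℤ)}
    (hmax : 2 * harborthNumber S.card ≤ (adjCount S : ℤ)) (f : ℤ × ℤ → ℤ)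
    (hf : ∀ p q : ℤ × ℤ, Adj p q → f q ≤ f p + 1) {p₁ p₂ : ℤ × ℤ} (hp₁ : p₁ ∈ S) (hp₂ : p₂ ∈ S)
    {v : ℤ} (h₁ : f p₁ ≤ v) (h₂ : v ≤ f p₂) : v ∈ S.image f := by
  classical
  by_contra hv
  have hv' : ∀ p ∈ S, f p ≠ v := fun p hp h => hv (mem_image.2 ⟨p, hp, h⟩)
  have h1' : f p₁ < v := lt_of_le_of_ne h₁ (hv' p₁ hp₁)
  have h2' : v < f p₂ := lt_of_le_of_ne h₂ (fun h => hv' p₂ hp₂ h.symm)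
  set A := S.filter fun p => f p < v with hA
  set B := S.filter fun p => v < f p with hB
  have hsplit := adjCount_split f v hf hv'
  rw [← hA, ← hB] at hsplit
  have hAne : 1 ≤ A.card := card_pos.2 ⟨p₁, mem_filter.2 ⟨hp₁, h1'⟩⟩
  have hBne : 1 ≤ B.card := card_pos.2 ⟨p₂, mem_filter.2 ⟨hp₂, h2'⟩⟩
  have hcard : A.card + B.card = S.card := by
    have hAB : Disjoint A B := by
      rw [hA, hB, disjoint_filter]; intro p _ h1 h2; omega
    have hS : S = A ∪ B := by
      ext p
      rw [Finset.mem_union, hA, hB, Finset.mem_filter, Finset.mem_filter]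
      constructor
      · intro hp
        rcases lt_or_gt_of_ne (hv' p hp) with h | h
        · exact Or.inl ⟨hp, h⟩
        · exact Or.inr ⟨hp, h⟩
      · rintro (⟨hp, -⟩ | ⟨hp, -⟩) <;> exact hp
    rw [← Finset.card_union_of_disjoint hAB, ← hS]
  have hA' := adjCount_le_two_mul_harborthNumber A
  have hB' := adjCount_le_two_mul_harborthNumber B
  have hsup := harborthNumber_superadditive hAne hBne
  rw [hcard] at hsup
  have : (adjCount S : ℤ) = adjCount A + adjCount B := by exact_mod_cast hsplit
  linarith

/-! ## §2 The bridge: hexagonal configurations and erosions -/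

/-- **`H_s + triPoint c ⊆ triPoint(S)` iff `c ∈ S ⊖ H_s`.** [cite: DavoliPiovanoStefanelli2017, (54) p. 641] -/
theorem hexConfig_triPoint_subset_iff {S : Finset (ℤ × ℤ)} {s : ℕ} {c : ℤ × ℤ} :
    hexConfig s (triPoint c) ⊆ ↑(S.image triPoint) ↔ c ∈ erodeN S s := by
  rw [mem_erodeN]
  unfold hexConfig
  constructor
  · intro h u hu
    have : triPoint u + triPoint c ∈ (↑(S.image triPoint) : Set Plane) :=
      h ⟨triPoint u, ⟨u, hu, rfl⟩, rfl⟩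
    rw [← map_add, Finset.mem_coe] at this
    obtain ⟨w, hw, hwe⟩ := Finset.mem_image.1 this
    rw [triPoint_injective hwe, add_comm] at hw
    exact hw
  · rintro h x ⟨y, ⟨u, hu, rfl⟩, rfl⟩
    show triPoint u + triPoint c ∈ (↑(S.image triPoint) : Set Plane)
    rw [← map_add, Finset.mem_coe]
    exact Finset.mem_image.2 ⟨u + c, by rw [add_comm]; exact h u hu, rfl⟩

/-- The set of admissible radii in (55) for `M = triPoint(S)` is `{s : S ⊖ H_s ≠ ∅}`.
[cite: DavoliPiovanoStefanelli2017, (55) p. 641] -/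
theorem radii_eq (S : Finset (ℤ × ℤ)) :
    {s : ℕ | ∃ q ∈ triangularLattice, hexConfig s q ⊆ ↑(S.image triPoint)} =
      {s : ℕ | (erodeN S s).Nonempty} := by
  ext s
  simp only [Set.mem_setOf_eq]
  constructor
  · rintro ⟨q, ⟨c, rfl⟩, h⟩
    exact ⟨c, hexConfig_triPoint_subset_iff.1 h⟩
  · rintro ⟨c, hc⟩
    exact ⟨triPoint c, ⟨c, rfl⟩, hexConfig_triPoint_subset_iff.2 hc⟩

/-- **The maximal radius (55) of `M = triPoint(S)`** is the largest `r` with `S ⊖ H_r ≠ ∅`: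
`S ⊖ H_r ≠ ∅` and `S ⊖ H_{r+1} = ∅` for `r = maxHexRadius M`. [cite: DavoliPiovanoStefanelli2017, (55) p. 641] -/
theorem maxHexRadius_image_triPoint_spec {S : Finset (ℤ × ℤ)} (hS : S.Nonempty) :
    (erodeN S (maxHexRadius (S.image triPoint))).Nonempty ∧
      erodeN S (maxHexRadius (S.image triPoint) + 1) = ∅ := by
  unfold maxHexRadius
  rw [radii_eq]
  set A := {s : ℕ | (erodeN S s).Nonempty} with hA
  have hne : A.Nonempty := ⟨0, by rw [hA, Set.mem_setOf_eq, erodeN_zero]; exact hS⟩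
  have hbdd : BddAbove A := ⟨S.card, fun s hs => (lt_card_of_erodeN_nonempty hs).le⟩
  refine ⟨Nat.sSup_mem hne hbdd, ?_⟩
  by_contra h
  have : sSup A + 1 ∈ A := Finset.nonempty_iff_ne_empty.2 h
  have := le_csSup hbdd this
  omega

/-! ## §3 Proposition 3.7: the lower bound on the maximal radius -/

/-- **Proposition 3.7 at label level.**  For a label set attaining Harborth's bound (an EIP minimizer)
with `S ⊖ H_r ≠ ∅ = S ⊖ H_{r+1}`:
`⌈α_n⌉/6 − 2 − (1/6)√(⌈α_n⌉² − α_n² + 75) ≤ r`, `α_n = √(12n − 3)` — from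
`n + 3(r+1)² ≤ (r+1)⌈α_n⌉ + 1`. [cite: DavoliPiovanoStefanelli2017, Proposition 3.7 (69)–(71) p. 651–652] -/
theorem radius_lower_bound {S : Finset (ℤ × ℤ)} (hS : S.Nonempty)
    (hmax : 2 * harborthNumber S.card ≤ (adjCount S : ℤ)) {r : ℕ}
    (hr : (erodeN S r).Nonempty) (hr' : erodeN S (r + 1) = ∅) :
    (⌈alpha S.card⌉ : ℝ) / 6 - 2 - 1 / 6 * Real.sqrt ((⌈alpha S.card⌉ : ℝ) ^ 2 - alpha S.card ^ 2 + 75)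
      ≤ r := by
  have hmain := card_add_sq_le_lineCount (isTriConvex_of_adjCount_eq hmax) hr hr'
  have hL := lineCount_eq_ceil hmax
  unfold alpha
  set c : ℤ := ⌈Real.sqrt (12 * S.card - 3)⌉ with hc
  have hn1 : (1 : ℝ) ≤ S.card := by exact_mod_cast hS.card_pos
  have hαsq : Real.sqrt (12 * (S.card : ℝ) - 3) ^ 2 = 12 * S.card - 3 := Real.sq_sqrt (by linarith)
  have hmainR : (S.card : ℝ) + 3 * ((r : ℝ) + 1) ^ 2 ≤ ((r : ℝ) + 1) * c + 1 := by
    have h1 : ((S.card + 3 * (r + 1) ^ 2 : ℕ) : ℤ) ≤ (((r + 1) * lineCount S + 1 : ℕ) : ℤ) := by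
      exact_mod_cast hmain
    push_cast at h1
    rw [hL] at h1
    exact_mod_cast h1
  have hsqrt_nn : 0 ≤ Real.sqrt (((c : ℝ)) ^ 2 - Real.sqrt (12 * (S.card : ℝ) - 3) ^ 2 + 75) :=
    Real.sqrt_nonneg _
  by_cases hcase : (c : ℝ) - 12 - 6 * r < 0
  · linarith
  · push Not at hcase
    have key : (c : ℝ) - 12 - 6 * r ≤
        Real.sqrt ((c : ℝ) ^ 2 - Real.sqrt (12 * (S.card : ℝ) - 3) ^ 2 + 75) := by
      calc (c : ℝ) - 12 - 6 * r = Real.sqrt (((c : ℝ) - 12 - 6 * r) ^ 2) := (Real.sqrt_sq hcase).symm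
        _ ≤ _ := Real.sqrt_le_sqrt (by rw [hαsq]; nlinarith)
    linarith

/-- **Davoli–Piovano–Stefanelli 2017, Proposition 3.7 — PROVED**: the named fact
`DavoliPiovanoStefanelli2017_maximalRadius` holds.  For every minimizer `M_n` of the
edge-isoperimetric problem on the triangular lattice, the maximal radius satisfies
`r_{M_n} ≥ ⌈α_n⌉/6 − 2 − (1/6)√(⌈α_n⌉² − α_n² + 75)`, `α_n = √(12n − 3)`.
[cite: DavoliPiovanoStefanelli2017, Proposition 3.7 (69)–(70) p. 651] -/
theorem DavoliPiovanoStefanelli2017_maximalRadius_holds : DavoliPiovanoStefanelli2017_maximalRadius := by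
  intro M hM hmin
  obtain ⟨S, rfl⟩ := exists_eq_image_triPoint hmin.1
  have hS : S.Nonempty := by
    obtain ⟨x, hx⟩ := hM
    obtain ⟨c, hc, -⟩ := Finset.mem_image.1 hx
    exact ⟨c, hc⟩
  have hmax := (isTriMinimizer_image_triPoint_iff S).1 hmin
  obtain ⟨hr, hr'⟩ := maxHexRadius_image_triPoint_spec hS
  rw [card_image_triPoint]
  exact radius_lower_bound hS hmax hr hr'

/-- **The `N^{3/4}` law with explicit lower-order terms** (cf. (24)/(74): `|M_n ∖ H_{r_{M_n}}| ≤
K_n n^{3/4} + o(n^{3/4})`, `K_n = (⌈α_n⌉/6n^{3/4})√(⌈α_n⌉² − α_n²)`): for every minimizer with label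
set `S`, `n − (3r² + 3r + 1) ≤ (r + 1)(⌈α_n⌉ − 6r − 3)`, where `3r² + 3r + 1 = #H_r` and
`6r + 3 ≤ ⌈α_n⌉`. [cite: DavoliPiovanoStefanelli2017, (74) p. 653] -/
theorem card_sub_card_hexagon_le {S : Finset (ℤ × ℤ)}
    (hmax : 2 * harborthNumber S.card ≤ (adjCount S : ℤ)) {r : ℕ}
    (hr : (erodeN S r).Nonempty) (hr' : erodeN S (r + 1) = ∅) :
    (S.card : ℤ) - (3 * r ^ 2 + 3 * r + 1) ≤ (r + 1) * (⌈Real.sqrt (12 * S.card - 3)⌉ - 6 * r - 3) ∧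
      6 * (r : ℤ) + 3 ≤ ⌈Real.sqrt (12 * S.card - 3)⌉ := by
  have hmain := card_add_sq_le_lineCount (isTriConvex_of_adjCount_eq hmax) hr hr'
  have hL := lineCount_eq_ceil hmax
  have h6 := six_mul_add_three_le_lineCount (S := S) hr
  have h1 : ((S.card + 3 * (r + 1) ^ 2 : ℕ) : ℤ) ≤ (((r + 1) * lineCount S + 1 : ℕ) : ℤ) := by
    exact_mod_cast hmain
  have h2 : ((6 * r + 3 : ℕ) : ℤ) ≤ lineCount S := by exact_mod_cast h6
  push_cast at h1 h2
  rw [hL] at h1 h2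
  constructor
  · nlinarith
  · linarith

/-! ## §4 Corollary 1.3: the Hausdorff distance to the maximal hexagon -/

/-- A unit lattice vector has Euclidean length one. [cite: Theil2006, §2.3 Remark 2.5] -/
private theorem norm_triPoint_eq_one {e : ℤ × ℤ} (he : normForm e = 1) : ‖triPoint e‖ = 1 := by
  have h := Theil2006.norm_triPoint_sq e
  have he' : (e.1 ^ 2 + e.1 * e.2 + e.2 ^ 2 : ℤ) = 1 := he
  rw [he'] at h
  push_cast at h
  nlinarith [norm_nonneg (triPoint e)]

/-- **Lattice paths are short**: a label of hexagonal norm `≤ t` has Euclidean norm `≤ t`.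
[cite: DavoliPiovanoStefanelli2017, p. 652 (proof of Corollary 1.3)] -/
theorem norm_triPoint_le_of_mem_hexagon {t : ℕ} {v : ℤ × ℤ} (hv : v ∈ hexagon t) :
    ‖triPoint v‖ ≤ t := by
  induction t generalizing v with
  | zero =>
    rw [Literature.Geometry.DiscreteGeometry.HarborthSpiral.hexagon_zero, Finset.mem_singleton] at hv
    subst hv
    simp [show ((0 : ℤ), (0 : ℤ)) = (0 : ℤ × ℤ) from rfl]
  | succ t ih =>
    by_cases h : v ∈ hexagon t
    · have := ih h
      push_cast
      linarith
    · obtain ⟨e, he, hve⟩ := exists_step_mem_hexagon hv h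
      have h1 := ih hve
      have h2 : triPoint v = triPoint e + triPoint (v - e) := by rw [← map_add]; congr 1; abel
      rw [h2]
      calc ‖triPoint e + triPoint (v - e)‖ ≤ ‖triPoint e‖ + ‖triPoint (v - e)‖ := norm_add_le _ _
        _ ≤ 1 + t := by rw [norm_triPoint_eq_one he]; linarith
        _ = ((t + 1 : ℕ) : ℝ) := by push_cast; ring

/-- **Radial retraction onto a hexagon**: a label within hexagonal distance `r + k` of the origin
is within Euclidean distance `k` of a label of `H_r`. [cite: DavoliPiovanoStefanelli2017, p. 652 (proof of Corollary 1.3)] -/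
theorem exists_mem_hexagon_norm_sub_le (r : ℕ) :
    ∀ k : ℕ, ∀ v : ℤ × ℤ, v ∈ hexagon (r + k) → ∃ u ∈ hexagon r, ‖triPoint (v - u)‖ ≤ k := by
  intro k
  induction k with
  | zero =>
    intro v hv
    exact ⟨v, hv, by simp⟩
  | succ k ih =>
    intro v hv
    by_cases h : v ∈ hexagon (r + k)
    · obtain ⟨u, hu, h'⟩ := ih v h
      exact ⟨u, hu, by push_cast; linarith⟩
    · rw [← add_assoc] at hv
      obtain ⟨e, he, hve⟩ := exists_step_mem_hexagon hv h
      obtain ⟨u, hu, h'⟩ := ih (v - e) hve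
      refine ⟨u, hu, ?_⟩
      have h2 : triPoint (v - u) = triPoint e + triPoint (v - e - u) := by
        rw [← map_add]; congr 1; abel
      rw [h2]
      calc ‖triPoint e + triPoint (v - e - u)‖ ≤ ‖triPoint e‖ + ‖triPoint (v - e - u)‖ :=
            norm_add_le _ _
        _ ≤ 1 + k := by rw [norm_triPoint_eq_one he]; linarith
        _ = ((k + 1 : ℕ) : ℝ) := by push_cast; ring

/-- An integer interval inside a finite set of values bounds its size from below.
[folklore] -/
private theorem sub_add_one_le_card {V : Finset ℤ} {a b : ℤ} (hab : a ≤ b)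
    (h : ∀ v, a ≤ v → v ≤ b → v ∈ V) : b - a + 1 ≤ V.card := by
  have hsub : Finset.Icc a b ⊆ V := fun v hv => by
    rw [Finset.mem_Icc] at hv; exact h v hv.1 hv.2
  have := Finset.card_le_card hsub
  rw [Int.card_Icc] at this
  have h' : ((b + 1 - a).toNat : ℤ) ≤ V.card := by exact_mod_cast this
  rw [Int.toNat_of_nonneg (by omega)] at h'
  omega

/-- **Every label of a minimizer lies within hexagonal distance `r + Λ` of the centre of a maximal
hexagon**, `Λ = L(S) − 3 − 6r` (`= p_n − 6 r_{M_n} ≥ max_k λ_k`, cf. (62)): in each direction the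
occupied lines form an interval of `W_i + 1` lines with `W_i ≥ 2r`, and `|f_i(z) − f_i(c)| ≤ W_i − r`.
[cite: DavoliPiovanoStefanelli2017, (62) p. 645 and p. 652] -/
theorem sub_mem_hexagon_of_mem {S : Finset (ℤ × ℤ)}
    (hmax : 2 * harborthNumber S.card ≤ (adjCount S : ℤ)) {r : ℕ} {c : ℤ × ℤ}
    (hc : c ∈ erodeN S r) {z : ℤ × ℤ} (hz : z ∈ S) {Λ : ℕ} (hΛ : lineCount S = 6 * r + 3 + Λ) :
    z - c ∈ hexagon (r + Λ) := by
  classical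
  rw [mem_erodeN] at hc
  -- between two attained values of an adjacency-Lipschitz coordinate, all values are attained
  have key : ∀ (f : ℤ × ℤ → ℤ), (∀ p q : ℤ × ℤ, Adj p q → f q ≤ f p + 1) →
      ∀ lo hi : ℤ × ℤ, lo ∈ S → hi ∈ S → f lo ≤ f hi → f hi - f lo + 1 ≤ ((S.image f).card : ℤ) := by
    intro f hf lo hi hlo hhi hle
    exact sub_add_one_le_card hle fun v hv1 hv2 =>
      values_ordConnected_of_adjCount_eq hmax f hf hlo hhi hv1 hv2
  -- for each coordinate: `#values ≥ |f z − f c| + r + 1` and `#values ≥ 2r + 1`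
  have coord : ∀ (f : ℤ × ℤ → ℤ), (∀ p q : ℤ × ℤ, Adj p q → f q ≤ f p + 1) →
      ∀ lo hi : ℤ × ℤ, lo ∈ S → hi ∈ S → f lo + r = f c → f c + r = f hi →
      f z - f c + r + 1 ≤ ((S.image f).card : ℤ) ∧ f c - f z + r + 1 ≤ ((S.image f).card : ℤ) ∧
        2 * (r : ℤ) + 1 ≤ ((S.image f).card : ℤ) := by
    intro f hf lo hi hlo hhi h1 h2
    have a := key f hf lo hi hlo hhi (by omega)
    refine ⟨?_, ?_, by omega⟩
    · rcases le_total (f hi) (f z) with h | h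
      · have b := key f hf lo z hlo hz (by omega); omega
      · omega
    · rcases le_total (f z) (f lo) with h | h
      · have b := key f hf z hi hz hhi (by omega); omega
      · omega
  -- adjacency changes each coordinate by at most one
  have hf2 : ∀ p q : ℤ × ℤ, Adj p q → q.2 ≤ p.2 + 1 := by
    intro p q h
    obtain ⟨a, b⟩ := p; obtain ⟨x, y⟩ := q
    unfold Adj at h; rw [Prod.mk_sub_mk, normForm_eq_one_iff] at h
    show y ≤ b + 1; omega
  have hf1 : ∀ p q : ℤ × ℤ, Adj p q → q.1 ≤ p.1 + 1 := by
    intro p q h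
    obtain ⟨a, b⟩ := p; obtain ⟨x, y⟩ := q
    unfold Adj at h; rw [Prod.mk_sub_mk, normForm_eq_one_iff] at h
    show x ≤ a + 1; omega
  have hf3 : ∀ p q : ℤ × ℤ, Adj p q → q.1 + q.2 ≤ (p.1 + p.2) + 1 := by
    intro p q h
    obtain ⟨a, b⟩ := p; obtain ⟨x, y⟩ := q
    unfold Adj at h; rw [Prod.mk_sub_mk, normForm_eq_one_iff] at h
    show x + y ≤ a + b + 1; omega
  -- the extreme labels `c ± r e` of the hexagon `c + H_r` lie in `S`
  have hmem : ∀ a b : ℤ, Inside r (a, b) → c + (a, b) ∈ S := fun a b h => hc _ (mem_hexagon.2 h)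
  have hup : c + (0, (r : ℤ)) ∈ S := hmem _ _ (by unfold Inside; simp only; omega)
  have hdn : c + (0, -(r : ℤ)) ∈ S := hmem _ _ (by unfold Inside; simp only; omega)
  have hrt : c + ((r : ℤ), 0) ∈ S := hmem _ _ (by unfold Inside; simp only; omega)
  have hlt : c + (-(r : ℤ), 0) ∈ S := hmem _ _ (by unfold Inside; simp only; omega)
  have k2 := coord Prod.snd hf2 _ _ hdn hup (by show c.2 + -(r : ℤ) + r = c.2; ring)
    (by show c.2 + (r : ℤ) = c.2 + r; ring)
  have k1 := coord Prod.fst hf1 _ _ hlt hrt (by show c.1 + -(r : ℤ) + r = c.1; ring)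
    (by show c.1 + (r : ℤ) = c.1 + r; ring)
  have k3 := coord (fun p => p.1 + p.2) hf3 _ _ hlt hrt
    (by show c.1 + -(r : ℤ) + (c.2 + 0) + r = c.1 + c.2; ring)
    (by show c.1 + c.2 + (r : ℤ) = c.1 + r + (c.2 + 0); ring)
  -- the three line counts add up to `L(S) = 6r + 3 + Λ`
  have hL : ((S.image Prod.snd).card : ℤ) + ((S.image fun p => p.1 + p.2).card : ℤ) +
      ((S.image Prod.fst).card : ℤ) = 6 * r + 3 + Λ := by
    have h0 : lineCount S = (S.image Prod.snd).card + (S.image fun p => p.1 + p.2).card +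
        (S.image Prod.fst).card := by
      unfold lineCount; rw [image_snd_image_rot6, image_snd_image_rot6_rot6]
    have h1 : (S.image Prod.snd).card + (S.image fun p => p.1 + p.2).card +
        (S.image Prod.fst).card = 6 * r + 3 + Λ := by rw [← h0, hΛ]
    exact_mod_cast h1
  -- conclude
  rw [mem_hexagon]
  unfold Inside
  simp only [Prod.fst_sub, Prod.snd_sub] at k3 ⊢
  push_cast
  omega

/-- **`Λ = ⌈α_n⌉ − 3 − 6r ≤ 3 + √(⌈α_n⌉² − α_n² + 9)`** for a minimizer (from
`n + 3(r+1)² ≤ (r+1)⌈α_n⌉ + 1`: `⌈α_n⌉² − α_n² ≥ Λ² − 6Λ`), and `⌈α_n⌉² − α_n² ≤ 2α_n + 1`,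
`√(2α_n) ≤ 2·3^{1/4} n^{1/4}`: hence `Λ ≤ 2·3^{1/4} n^{1/4} + 3 + √10`.
[cite: DavoliPiovanoStefanelli2017, p. 652 (proof of Corollary 1.3)] -/
theorem lambda_le {S : Finset (ℤ × ℤ)} (hS : S.Nonempty)
    (hmax : 2 * harborthNumber S.card ≤ (adjCount S : ℤ)) {r : ℕ}
    (hr : (erodeN S r).Nonempty) (hr' : erodeN S (r + 1) = ∅) {Λ : ℕ}
    (hΛ : lineCount S = 6 * r + 3 + Λ) :
    (Λ : ℝ) ≤ 2 * (3 : ℝ) ^ (1 / 4 : ℝ) * (S.card : ℝ) ^ (1 / 4 : ℝ) + (3 + Real.sqrt 10) := by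
  have hmain := card_add_sq_le_lineCount (isTriConvex_of_adjCount_eq hmax) hr hr'
  have hL := lineCount_eq_ceil hmax
  set α := Real.sqrt (12 * (S.card : ℝ) - 3) with hα
  set c : ℤ := ⌈α⌉ with hc
  have hn1 : (1 : ℝ) ≤ S.card := by exact_mod_cast hS.card_pos
  have hαsq : α ^ 2 = 12 * S.card - 3 := Real.sq_sqrt (by linarith)
  have hα0 : 0 ≤ α := Real.sqrt_nonneg _
  have hcα : α ≤ c := Int.le_ceil α
  have hcα' : (c : ℝ) < α + 1 := Int.ceil_lt_add_one α
  have hcR : (c : ℝ) = 6 * r + 3 + Λ := by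
    have : ((lineCount S : ℕ) : ℤ) = ((6 * r + 3 + Λ : ℕ) : ℤ) := by rw [hΛ]
    rw [hL] at this
    have h2 : (c : ℝ) = (((6 * r + 3 + Λ : ℕ) : ℤ) : ℝ) := by rw [this]
    rw [h2]; push_cast; ring
  have hmainR : (S.card : ℝ) + 3 * ((r : ℝ) + 1) ^ 2 ≤ ((r : ℝ) + 1) * c + 1 := by
    have h1 : ((S.card + 3 * (r + 1) ^ 2 : ℕ) : ℤ) ≤ (((r + 1) * lineCount S + 1 : ℕ) : ℤ) := by
      exact_mod_cast hmain
    push_cast at h1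
    rw [hL] at h1
    exact_mod_cast h1
  -- Step 1: `(Λ − 3)² ≤ c² − α² + 9 ≤ 2α + 10`, so `Λ ≤ 3 + √(2α + 10)`
  have hΛ0 : (0 : ℝ) ≤ Λ := Nat.cast_nonneg Λ
  have hr0 : (0 : ℝ) ≤ r := Nat.cast_nonneg r
  rw [hcR] at hmainR hcα hcα'
  have h1 : α ^ 2 ≤ (6 * r + 3) ^ 2 + 12 * (r + 1) * Λ := by nlinarith
  have h2 : (6 * (r : ℝ) + 3 + Λ) ^ 2 < (α + 1) ^ 2 := by nlinarith
  have h12 : ((Λ : ℝ) - 3) ^ 2 ≤ 2 * α + 10 := by nlinarith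
  have step1 : (Λ : ℝ) ≤ 3 + Real.sqrt (2 * α + 10) := by
    by_cases h3 : (Λ : ℝ) < 3
    · linarith [Real.sqrt_nonneg (2 * α + 10)]
    · push Not at h3
      have : (Λ : ℝ) - 3 ≤ Real.sqrt (2 * α + 10) := by
        calc (Λ : ℝ) - 3 = Real.sqrt (((Λ : ℝ) - 3) ^ 2) := (Real.sqrt_sq (by linarith)).symm
          _ ≤ Real.sqrt (2 * α + 10) := Real.sqrt_le_sqrt h12
      linarith
  -- Step 2: `√(2α + 10) ≤ √(2α) + √10` and `√(2α) ≤ 2 · 3^{1/4} · n^{1/4}`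
  have step2 : Real.sqrt (2 * α + 10) ≤ Real.sqrt (2 * α) + Real.sqrt 10 := by
    have ha : 0 ≤ Real.sqrt (2 * α) := Real.sqrt_nonneg _
    have hb : 0 ≤ Real.sqrt 10 := Real.sqrt_nonneg _
    calc Real.sqrt (2 * α + 10) ≤ Real.sqrt ((Real.sqrt (2 * α) + Real.sqrt 10) ^ 2) :=
          Real.sqrt_le_sqrt (by
            nlinarith [Real.sq_sqrt (show (0 : ℝ) ≤ 2 * α by linarith),
              Real.sq_sqrt (show (0 : ℝ) ≤ 10 by norm_num), mul_nonneg ha hb])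
      _ = Real.sqrt (2 * α) + Real.sqrt 10 := Real.sqrt_sq (by linarith)
  have step3 : Real.sqrt (2 * α) ≤ 2 * (3 : ℝ) ^ (1 / 4 : ℝ) * (S.card : ℝ) ^ (1 / 4 : ℝ) := by
    have h3 : 0 ≤ (3 : ℝ) ^ (1 / 4 : ℝ) := Real.rpow_nonneg (by norm_num) _
    have hn : 0 ≤ (S.card : ℝ) ^ (1 / 4 : ℝ) := Real.rpow_nonneg (by linarith) _
    have hB : 0 ≤ 2 * (3 : ℝ) ^ (1 / 4 : ℝ) * (S.card : ℝ) ^ (1 / 4 : ℝ) := by positivity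
    refine le_of_pow_le_pow_left₀ (by norm_num : (4 : ℕ) ≠ 0) hB ?_
    have e3 : ((3 : ℝ) ^ (1 / 4 : ℝ)) ^ 4 = 3 := by
      rw [← Real.rpow_natCast, ← Real.rpow_mul (by norm_num)]; norm_num
    have en : ((S.card : ℝ) ^ (1 / 4 : ℝ)) ^ 4 = S.card := by
      rw [← Real.rpow_natCast, ← Real.rpow_mul (by linarith)]; norm_num
    have e2 : Real.sqrt (2 * α) ^ 4 = (2 * α) ^ 2 := by
      rw [show (4 : ℕ) = 2 * 2 from rfl, pow_mul, Real.sq_sqrt (by linarith)]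
    rw [e2]
    simp only [mul_pow]
    rw [e3, en]
    nlinarith [hαsq]
  linarith

/-- **Davoli–Piovano–Stefanelli 2017, Corollary 1.3 (Hausdorff distance) — PROVED**: the named fact
`DavoliPiovanoStefanelli2017_hausdorff` holds with the explicit constant `C = 3 + √10`: every
minimizer `M_n` contains a hexagonal configuration `H` of maximal radius `r_{M_n}` with
`d_H(M_n, H) ≤ 2·3^{1/4} n^{1/4} + 3 + √10`. [cite: DavoliPiovanoStefanelli2017, Corollary 1.3 (20) p. 633; proof p. 652] -/
theorem DavoliPiovanoStefanelli2017_hausdorff_holds : DavoliPiovanoStefanelli2017_hausdorff := by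
  refine ⟨3 + Real.sqrt 10, fun M hM hmin => ?_⟩
  obtain ⟨S, rfl⟩ := exists_eq_image_triPoint hmin.1
  have hS : S.Nonempty := by
    obtain ⟨x, hx⟩ := hM
    obtain ⟨c, hc, -⟩ := Finset.mem_image.1 hx
    exact ⟨c, hc⟩
  have hmax := (isTriMinimizer_image_triPoint_iff S).1 hmin
  obtain ⟨hr, hr'⟩ := maxHexRadius_image_triPoint_spec hS
  set r := maxHexRadius (S.image triPoint) with hrdef
  obtain ⟨c, hc⟩ := hr
  have h6 := six_mul_add_three_le_lineCount (S := S) ⟨c, hc⟩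
  obtain ⟨Λ, hΛ⟩ : ∃ Λ : ℕ, lineCount S = 6 * r + 3 + Λ := ⟨lineCount S - (6 * r + 3), by omega⟩
  have hΛle := lambda_le hS hmax ⟨c, hc⟩ hr' hΛ
  refine ⟨triPoint c, ⟨c, rfl⟩, hexConfig_triPoint_subset_iff.2 hc, ?_⟩
  rw [card_image_triPoint]
  refine le_trans ?_ hΛle
  refine Metric.hausdorffDist_le_of_mem_dist (Nat.cast_nonneg Λ) ?_ ?_
  · -- every label of `S` is `Λ`-close to the hexagon
    intro x hx
    rw [Finset.mem_coe] at hx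
    obtain ⟨z, hz, rfl⟩ := Finset.mem_image.1 hx
    have hzc := sub_mem_hexagon_of_mem hmax hc hz hΛ
    obtain ⟨u, hu, hdist⟩ := exists_mem_hexagon_norm_sub_le r Λ (z - c) hzc
    refine ⟨triPoint u + triPoint c, ⟨triPoint u, ⟨u, hu, rfl⟩, rfl⟩, ?_⟩
    rw [dist_eq_norm, ← map_add, ← map_sub]
    have e : z - (u + c) = z - c - u := by abel
    rw [e]
    exact hdist
  · -- the hexagon lies in `M`
    intro y hy
    exact ⟨y, hexConfig_triPoint_subset_iff.2 hc hy, by rw [dist_self]; exact Nat.cast_nonneg Λ⟩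

/-! ## §5 Theorem 1.2 (15): the `N^{3/4}` law with the sharp constant `K_t = 2/3^{1/4}` -/

/-- `Λ = L(S) − 6r − 3 ≤ 3 + √(2α_n + 10)` for a minimizer (`α_n = √(12n − 3)`): from
`n + 3(r+1)² ≤ (r+1)⌈α_n⌉ + 1` one gets `Λ² − 6Λ ≤ ⌈α_n⌉² − α_n² < 2α_n + 1`.
[cite: DavoliPiovanoStefanelli2017, (69)–(74) p. 651–653] -/
theorem lambda_le_sqrt {S : Finset (ℤ × ℤ)} (hS : S.Nonempty)
    (hmax : 2 * harborthNumber S.card ≤ (adjCount S : ℤ)) {r : ℕ}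
    (hr : (erodeN S r).Nonempty) (hr' : erodeN S (r + 1) = ∅) {Λ : ℕ}
    (hΛ : lineCount S = 6 * r + 3 + Λ) :
    (Λ : ℝ) ≤ 3 + Real.sqrt (2 * Real.sqrt (12 * S.card - 3) + 10) := by
  have hmain := card_add_sq_le_lineCount (isTriConvex_of_adjCount_eq hmax) hr hr'
  have hL := lineCount_eq_ceil hmax
  set α := Real.sqrt (12 * (S.card : ℝ) - 3) with hα
  set c : ℤ := ⌈α⌉ with hc
  have hn1 : (1 : ℝ) ≤ S.card := by exact_mod_cast hS.card_pos
  have hαsq : α ^ 2 = 12 * S.card - 3 := Real.sq_sqrt (by linarith)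
  have hα0 : 0 ≤ α := Real.sqrt_nonneg _
  have hcα : α ≤ c := Int.le_ceil α
  have hcα' : (c : ℝ) < α + 1 := Int.ceil_lt_add_one α
  have hcR : (c : ℝ) = 6 * r + 3 + Λ := by
    have : ((lineCount S : ℕ) : ℤ) = ((6 * r + 3 + Λ : ℕ) : ℤ) := by rw [hΛ]
    rw [hL] at this
    have h2 : (c : ℝ) = (((6 * r + 3 + Λ : ℕ) : ℤ) : ℝ) := by rw [this]
    rw [h2]; push_cast; ring
  have hmainR : (S.card : ℝ) + 3 * ((r : ℝ) + 1) ^ 2 ≤ ((r : ℝ) + 1) * c + 1 := by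
    have h1 : ((S.card + 3 * (r + 1) ^ 2 : ℕ) : ℤ) ≤ (((r + 1) * lineCount S + 1 : ℕ) : ℤ) := by
      exact_mod_cast hmain
    push_cast at h1
    rw [hL] at h1
    exact_mod_cast h1
  have hΛ0 : (0 : ℝ) ≤ Λ := Nat.cast_nonneg Λ
  have hr0 : (0 : ℝ) ≤ r := Nat.cast_nonneg r
  rw [hcR] at hmainR hcα hcα'
  have h1 : α ^ 2 ≤ (6 * r + 3) ^ 2 + 12 * (r + 1) * Λ := by nlinarith
  have h2 : (6 * (r : ℝ) + 3 + Λ) ^ 2 < (α + 1) ^ 2 := by nlinarith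
  have h12 : ((Λ : ℝ) - 3) ^ 2 ≤ 2 * α + 10 := by nlinarith
  by_cases h3 : (Λ : ℝ) < 3
  · linarith [Real.sqrt_nonneg (2 * α + 10)]
  · push Not at h3
    have : (Λ : ℝ) - 3 ≤ Real.sqrt (2 * α + 10) := by
      calc (Λ : ℝ) - 3 = Real.sqrt (((Λ : ℝ) - 3) ^ 2) := (Real.sqrt_sq (by linarith)).symm
        _ ≤ Real.sqrt (2 * α + 10) := Real.sqrt_le_sqrt h12
    linarith

/-- **(24)/(74) with explicit lower-order terms**: for every EIP minimizer with label set `S` and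
maximal radius `r`, `n − #H_r ≤ ((α_n + 4)/6)(3 + √(2α_n + 10))` (the printed leading term is
`K_n n^{3/4} = (⌈α_n⌉/6)√(⌈α_n⌉² − α_n²)`, `⌈α_n⌉² − α_n² < 2α_n + 1`).
[cite: DavoliPiovanoStefanelli2017, (73)–(74) p. 653] -/
theorem card_sub_card_hexagon_le_real {S : Finset (ℤ × ℤ)} (hS : S.Nonempty)
    (hmax : 2 * harborthNumber S.card ≤ (adjCount S : ℤ)) {r : ℕ}
    (hr : (erodeN S r).Nonempty) (hr' : erodeN S (r + 1) = ∅) :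
    (S.card : ℝ) - (3 * (r : ℝ) ^ 2 + 3 * r + 1) ≤
      (alpha S.card + 4) / 6 * (3 + Real.sqrt (2 * alpha S.card + 10)) := by
  have h6 := six_mul_add_three_le_lineCount (S := S) hr
  obtain ⟨Λ, hΛ⟩ : ∃ Λ : ℕ, lineCount S = 6 * r + 3 + Λ := ⟨lineCount S - (6 * r + 3), by omega⟩
  have hΛle := lambda_le_sqrt hS hmax hr hr' hΛ
  obtain ⟨h1, -⟩ := card_sub_card_hexagon_le hmax hr hr'
  have hL := lineCount_eq_ceil hmax
  unfold alpha
  set α := Real.sqrt (12 * (S.card : ℝ) - 3) with hα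
  have hcα' : ((⌈α⌉ : ℤ) : ℝ) < α + 1 := Int.ceil_lt_add_one α
  have hcR : ((⌈α⌉ : ℤ) : ℝ) = 6 * r + 3 + Λ := by
    have : ((lineCount S : ℕ) : ℤ) = ((6 * r + 3 + Λ : ℕ) : ℤ) := by rw [hΛ]
    rw [hL] at this
    have h2 : ((⌈α⌉ : ℤ) : ℝ) = (((6 * r + 3 + Λ : ℕ) : ℤ) : ℝ) := by rw [this]
    rw [h2]; push_cast; ring
  have h1R : (S.card : ℝ) - (3 * (r : ℝ) ^ 2 + 3 * r + 1) ≤ ((r : ℝ) + 1) * Λ := by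
    have h1' : ((S.card : ℤ) : ℝ) - (3 * (r : ℝ) ^ 2 + 3 * r + 1) ≤
        ((r : ℝ) + 1) * (((⌈α⌉ : ℤ) : ℝ) - 6 * r - 3) := by exact_mod_cast h1
    rw [hcR] at h1'
    have e : ((r : ℝ) + 1) * (6 * r + 3 + (Λ : ℝ) - 6 * r - 3) = ((r : ℝ) + 1) * Λ := by ring
    rw [e] at h1'
    exact_mod_cast h1'
  have hΛ0 : (0 : ℝ) ≤ Λ := Nat.cast_nonneg Λ
  have hα0 : 0 ≤ α := Real.sqrt_nonneg _
  have hr1 : (r : ℝ) + 1 ≤ (α + 4 - Λ) / 6 := by linarith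
  calc (S.card : ℝ) - (3 * (r : ℝ) ^ 2 + 3 * r + 1) ≤ ((r : ℝ) + 1) * Λ := h1R
    _ ≤ (α + 4 - Λ) / 6 * Λ := mul_le_mul_of_nonneg_right hr1 hΛ0
    _ ≤ (α + 4) / 6 * Λ := by nlinarith
    _ ≤ (α + 4) / 6 * (3 + Real.sqrt (2 * α + 10)) :=
        mul_le_mul_of_nonneg_left hΛle (by positivity)

/-- **Davoli–Piovano–Stefanelli 2017, Theorem 1.2 (15) with the sharp constant, explicitly**: every
minimizer `M_n` of the EIP on the triangular lattice (label set `S`, maximal radius `r`) satisfies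
`|M_n ∖ H_{r_{M_n}}| = n − (3r² + 3r + 1) ≤ K_t n^{3/4} + 6√n + 5`, `K_t = 2/3^{1/4}` (19).
(`(α_n/6)√(2α_n) ≤ K_t n^{3/4}` since `α_n⁶ = (12n − 3)³ ≤ (12n)³`; the remaining terms are `O(√n)`.)
[cite: DavoliPiovanoStefanelli2017, Theorem 1.2 (15), (19) p. 632; (24) p. 634] -/
theorem card_sub_card_hexagon_le_sharpConstant {S : Finset (ℤ × ℤ)} (hS : S.Nonempty)
    (hmax : 2 * harborthNumber S.card ≤ (adjCount S : ℤ)) {r : ℕ}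
    (hr : (erodeN S r).Nonempty) (hr' : erodeN S (r + 1) = ∅) :
    (S.card : ℝ) - (3 * (r : ℝ) ^ 2 + 3 * r + 1) ≤
      sharpConstant * (S.card : ℝ) ^ (3 / 4 : ℝ) + 6 * Real.sqrt S.card + 5 := by
  have h := card_sub_card_hexagon_le_real hS hmax hr hr'
  unfold alpha at h
  unfold sharpConstant
  set α := Real.sqrt (12 * (S.card : ℝ) - 3) with hα
  have hn1 : (1 : ℝ) ≤ S.card := by exact_mod_cast hS.card_pos
  have hn0 : (0 : ℝ) ≤ S.card := by linarith
  have hαsq : α ^ 2 = 12 * S.card - 3 := Real.sq_sqrt (by linarith)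
  have hα3 : 3 ≤ α := three_le_sqrt hS.card_pos
  have hα0 : 0 ≤ α := by linarith
  -- `s = √n`
  set s := Real.sqrt (S.card : ℝ) with hs
  have hssq : s ^ 2 = S.card := Real.sq_sqrt hn0
  have hs0 : 0 ≤ s := Real.sqrt_nonneg _
  have hs1 : 1 ≤ s := by
    calc (1 : ℝ) = Real.sqrt (1 ^ 2) := by rw [Real.sqrt_sq zero_le_one]
      _ ≤ s := Real.sqrt_le_sqrt (by linarith)
  -- `α ≤ 3.47 √n`
  have hαs : α ≤ 347 / 100 * s := by
    calc α = Real.sqrt (12 * (S.card : ℝ) - 3) := rfl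
      _ ≤ Real.sqrt ((347 / 100 * s) ^ 2) := Real.sqrt_le_sqrt (by nlinarith)
      _ = 347 / 100 * s := Real.sqrt_sq (by positivity)
  -- `t = √(2α)`, `t ≤ α`
  set t := Real.sqrt (2 * α) with ht
  have ht0 : 0 ≤ t := Real.sqrt_nonneg _
  have htsq : t ^ 2 = 2 * α := Real.sq_sqrt (by linarith)
  have htα : t ≤ α := le_of_pow_le_pow_left₀ two_ne_zero hα0 (by rw [htsq]; nlinarith)
  -- `√10 ≤ 3.17`
  have hq : Real.sqrt 10 ≤ 317 / 100 := by
    calc Real.sqrt 10 ≤ Real.sqrt ((317 / 100) ^ 2) := Real.sqrt_le_sqrt (by norm_num)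
      _ = 317 / 100 := Real.sqrt_sq (by norm_num)
  have hq0 : 0 ≤ Real.sqrt 10 := Real.sqrt_nonneg _
  -- `√(2α + 10) ≤ t + √10`
  have hsplit : Real.sqrt (2 * α + 10) ≤ t + Real.sqrt 10 := by
    calc Real.sqrt (2 * α + 10) ≤ Real.sqrt ((t + Real.sqrt 10) ^ 2) :=
          Real.sqrt_le_sqrt (by
            nlinarith [Real.sq_sqrt (show (0 : ℝ) ≤ 10 by norm_num), mul_nonneg ht0 hq0])
      _ = t + Real.sqrt 10 := Real.sqrt_sq (by linarith)
  -- the leading term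
  have hmainT : α / 6 * t ≤ 2 / (3 : ℝ) ^ (1 / 4 : ℝ) * (S.card : ℝ) ^ (3 / 4 : ℝ) := by
    have h3pos : 0 < (3 : ℝ) ^ (1 / 4 : ℝ) := Real.rpow_pos_of_pos (by norm_num) _
    have hB : 0 ≤ 2 / (3 : ℝ) ^ (1 / 4 : ℝ) * (S.card : ℝ) ^ (3 / 4 : ℝ) := by positivity
    refine le_of_pow_le_pow_left₀ (by norm_num : (4 : ℕ) ≠ 0) hB ?_
    have e3 : ((3 : ℝ) ^ (1 / 4 : ℝ)) ^ 4 = 3 := by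
      rw [← Real.rpow_natCast, ← Real.rpow_mul (by norm_num)]; norm_num
    have en : ((S.card : ℝ) ^ (3 / 4 : ℝ)) ^ 4 = (S.card : ℝ) ^ 3 := by
      rw [← Real.rpow_natCast, ← Real.rpow_mul hn0, ← Real.rpow_natCast (S.card : ℝ) 3]
      norm_num
    have ht4 : t ^ 4 = (2 * α) ^ 2 := by
      rw [show (4 : ℕ) = 2 * 2 from rfl, pow_mul, htsq]
    have hα6 : (α ^ 2) ^ 3 ≤ (12 * (S.card : ℝ)) ^ 3 :=
      pow_le_pow_left₀ (by positivity) (by linarith) 3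
    simp only [mul_pow, div_pow]
    rw [ht4, e3, en]
    nlinarith [hα6]
  -- the lower-order terms
  have e1 : (α + 4) / 6 * (3 + Real.sqrt (2 * α + 10)) ≤ (α + 4) / 6 * (3 + t + Real.sqrt 10) :=
    mul_le_mul_of_nonneg_left (by linarith) (by positivity)
  have e2 : (α + 4) / 6 * (3 + t + Real.sqrt 10) =
      α / 6 * t + (4 * t + (α + 4) * (3 + Real.sqrt 10)) / 6 := by ring
  have e3 : (α + 4) * (3 + Real.sqrt 10) ≤ (α + 4) * (617 / 100) :=
    mul_le_mul_of_nonneg_left (by linarith) (by linarith)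
  have e4 : (4 * t + (α + 4) * (3 + Real.sqrt 10)) / 6 ≤ 6 * s + 5 := by
    have : 4 * t + (α + 4) * (617 / 100) ≤ 36 * s + 30 := by nlinarith
    linarith
  linarith

/-- The number of labels of the lattice hexagon `H_r` as a real number: `3r² + 3r + 1`.
[cite: DavoliPiovanoStefanelli2017, (56) p. 641] -/
theorem card_hexagon_real (r : ℕ) : ((hexagon r).card : ℝ) = 3 * (r : ℝ) ^ 2 + 3 * r + 1 := by
  rw [Schmidt2013.card_hexagon]; push_cast; ring

/-- **Davoli–Piovano–Stefanelli 2017, Theorem 1.2 (15) for every minimizer**: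
`|M_n ∖ H_{r_{M_n}}| ≤ K_t n^{3/4} + 6√n + 5` in the vocabulary of the named fact
`DavoliPiovanoStefanelli2017_wulffShape` (`maxHexRadius`, `hexagon`, `sharpConstant`).
[cite: DavoliPiovanoStefanelli2017, Theorem 1.2 (15), (19) p. 632] -/
theorem card_sub_card_maxHexagon_le {M : Finset Plane} (hM : M.Nonempty) (hmin : IsTriMinimizer M) :
    (M.card : ℝ) - ((hexagon (maxHexRadius M)).card : ℝ) ≤
      sharpConstant * (M.card : ℝ) ^ (3 / 4 : ℝ) + 6 * Real.sqrt M.card + 5 := by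
  obtain ⟨S, rfl⟩ := exists_eq_image_triPoint hmin.1
  have hS : S.Nonempty := by
    obtain ⟨x, hx⟩ := hM
    obtain ⟨c, hc, -⟩ := Finset.mem_image.1 hx
    exact ⟨c, hc⟩
  have hmax := (isTriMinimizer_image_triPoint_iff S).1 hmin
  obtain ⟨hr, hr'⟩ := maxHexRadius_image_triPoint_spec hS
  rw [card_image_triPoint, card_hexagon_real]
  exact card_sub_card_hexagon_le_sharpConstant hS hmax hr hr'

/-- **The `N^{3/4}` law, asymptotic form (15), uniformly over minimizers**: for every `δ > 0`, for
all sufficiently large `n`, EVERY minimizer `M_n` with `n` points satisfies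
`|M_n ∖ H_{r_{M_n}}| ≤ (K_t + δ) n^{3/4}` — the (15)-clause of Theorem 1.2 holds along every
sequence of minimizers. [cite: DavoliPiovanoStefanelli2017, Theorem 1.2 (15) p. 632; (81) p. 655] -/
theorem eventually_card_sub_card_maxHexagon_le {δ : ℝ} (hδ : 0 < δ) :
    ∀ᶠ n : ℕ in atTop, ∀ M : Finset Plane, IsTriMinimizer M → M.card = n →
      (n : ℝ) - ((hexagon (maxHexRadius M)).card : ℝ) ≤ (sharpConstant + δ) * (n : ℝ) ^ (3 / 4 : ℝ) := by
  rw [Filter.eventually_atTop]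
  refine ⟨⌈(11 / δ) ^ 4⌉₊ + 1, fun n hn M hmin hcard => ?_⟩
  have hn1 : 1 ≤ n := by omega
  have hM : M.Nonempty := Finset.card_pos.1 (by rw [hcard]; exact hn1)
  have h := card_sub_card_maxHexagon_le hM hmin
  rw [hcard] at h
  -- `6 √n + 5 ≤ 11 √n ≤ δ n^{3/4}` for `n ≥ (11/δ)⁴`
  have hnR : (1 : ℝ) ≤ n := by exact_mod_cast hn1
  have hn0 : (0 : ℝ) < n := by linarith
  have hnge : (11 / δ) ^ 4 ≤ (n : ℝ) := by
    have h1 : ((⌈(11 / δ) ^ 4⌉₊ : ℕ) : ℝ) + 1 ≤ n := by exact_mod_cast hn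
    linarith [Nat.le_ceil ((11 / δ) ^ 4)]
  have hδ' : 0 ≤ 11 / δ := by positivity
  have hroot : 11 / δ ≤ (n : ℝ) ^ (1 / 4 : ℝ) := by
    calc 11 / δ = ((11 / δ) ^ 4) ^ (1 / 4 : ℝ) := by
          rw [← Real.rpow_natCast, ← Real.rpow_mul hδ']; norm_num
      _ ≤ (n : ℝ) ^ (1 / 4 : ℝ) := Real.rpow_le_rpow (by positivity) hnge (by norm_num)
  have hsqrt : Real.sqrt n = (n : ℝ) ^ (1 / 2 : ℝ) := Real.sqrt_eq_rpow n
  have hsplit : (n : ℝ) ^ (3 / 4 : ℝ) = (n : ℝ) ^ (1 / 2 : ℝ) * (n : ℝ) ^ (1 / 4 : ℝ) := by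
    rw [← Real.rpow_add hn0]; norm_num
  have hs0 : 0 ≤ Real.sqrt n := Real.sqrt_nonneg _
  have hs1 : 1 ≤ Real.sqrt n := by
    calc (1 : ℝ) = Real.sqrt (1 ^ 2) := by rw [Real.sqrt_sq zero_le_one]
      _ ≤ Real.sqrt n := Real.sqrt_le_sqrt (by linarith)
  have key : 11 * Real.sqrt n ≤ δ * (n : ℝ) ^ (3 / 4 : ℝ) := by
    rw [hsplit, ← hsqrt]
    have : 11 * Real.sqrt n ≤ δ * (Real.sqrt n * (11 / δ)) := by
      rw [show δ * (Real.sqrt n * (11 / δ)) = 11 * Real.sqrt n from by field_simp]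
    calc 11 * Real.sqrt n ≤ δ * (Real.sqrt n * (11 / δ)) := this
      _ ≤ δ * (Real.sqrt n * (n : ℝ) ^ (1 / 4 : ℝ)) := by
          gcongr
  calc (n : ℝ) - ((hexagon (maxHexRadius M)).card : ℝ)
      ≤ sharpConstant * (n : ℝ) ^ (3 / 4 : ℝ) + 6 * Real.sqrt n + 5 := h
    _ ≤ sharpConstant * (n : ℝ) ^ (3 / 4 : ℝ) + 11 * Real.sqrt n := by linarith
    _ ≤ sharpConstant * (n : ℝ) ^ (3 / 4 : ℝ) + δ * (n : ℝ) ^ (3 / 4 : ℝ) := by linarith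
    _ = (sharpConstant + δ) * (n : ℝ) ^ (3 / 4 : ℝ) := by ring

end Literature.MathematicalPhysics.StatisticalMechanics.DavoliPiovanoStefanelli2017

end
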